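import Summits.QuantumAdvantage.QuantumAdvantage.Theorems.AnchorDialGeneric

/-!
# AnchorDial — part 13/13 «Anchored» (cell decomp-qadv, seat lens-2, generation 14 rev 7; supports item 26531 `ExactnessDial.PolyLossOddU3`)

§12g–§12h of the node (rev 7).  THE LAW AT STRATEGY LEVEL, FAITHFUL ±1-JITTER FORM: **`anchoredDev_loss`** — a
degree-`(log₂ n)^c` strategy with a degree-`(log₂ n)^c` coarse anchor family (a.e. unique, flip-stable on average, AT or
ONE STEP BELOW the a.e.-unique deviation point; the point itself may jump within the pair along flip orbits — not frozen,
so the degree-free law is silent) LOSES on `≥ 2^{n-1}/49` odd inputs (`pointer_certificate_loss` with the selector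
`f_k := devA P k`); `Anchorable`, the re-typed residual **`NoAnchorLoss3`** (= `T` on un-anchorable strategies),
`noAnchorLoss3_of_polyLossOddU3`, **`polyLossOddU3_of_noAnchorLoss3`** (dichotomy), **`polyLossOddU3_iff_noAnchorLoss3`**,
`noAnchorLoss3_iff_multiDevLoss3`, **`closes_noAnchor : NoAnchorLoss3 → DPLift3 → AdviceFreeQNC0Three`**,
`not_anchorable_canonical` (non-vacuity), `anchorable_of_uniDev_stabDev` (the anchorable class CONTAINS the level-0
class of part 12, one degree step up).  §12h TIGHTNESS **`anchoredDev_loss_needs_degree`**: `gCond_succ_of_not` (adjacent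
positions never null), `jitPtr`/`jitStrat`/`zeroAnchor`: with the constant anchor `[k = 0]` the unbounded-degree ±1 jitter
strategy wins on EVERY odd input with all exceptional sets empty — the degree hypothesis of `anchoredDev_loss` is NECESSARY.
Declarations verbatim from the node file `HOME/decomp-qadv-lens-2/g14/AnchorDial.lean` (rev 7); namespace
`Summit.QuantumAdvantage.QuantumAdvantage.Theorems.AnchorDial`.  Imports part 12.  Joint check `tree/Chain13.check.lean`.  Record: NODE-g14.md §REV 7.
Prop defs (`Anchorable`, `NoAnchorLoss3`) are statements of the node: `NoAnchorLoss3` is the typed residual (≡ 26531), not a new crux.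
-/

set_option linter.dupNamespace false
set_option linter.unusedVariables false

noncomputable section

open scoped Classical

namespace Summit.QuantumAdvantage.QuantumAdvantage.Theorems.AnchorDial

open Finset
open Literature.Computability.QuantumComplexity Literature.Computability.QuantumComplexity.RingHLF
open Literature.Computability.MetaComplexity Literature.Computability.MetaComplexity.Smolensky
open Summit.QuantumAdvantage.AdviceFreeQNC0
open Summit.QuantumAdvantage.QuantumAdvantage.Theses (ExactnessDial.PolyLossOddU3 ExactnessDial.DPLift3)
open Summit.QuantumAdvantage.QuantumAdvantage.Theorems.HolonomyDial (gCond tPoly tPoly_mem tPoly_apply selP selP_mem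
  selP_apply xorP xorP_mem xorP_apply_bool closes_T)

variable {N : ℕ}

section Anchored

/-- **THE LAW AT STRATEGY LEVEL, faithful form (what `MovingPointerLoss3` really says about strategies).**  A
degree-`(log₂ n)^c` strategy `P` together with a degree-`(log₂ n)^c` COARSE ANCHOR family `A` — (UNIQ) exactly one
anchor on all but `2^{-12}` of the odd class, (STAB) anchors flip-stable up to an average `2^{-12}`, (UNI) the
deviation set of `P` a single point a.e., (NEAR) the anchor AT or ONE STEP (cyclically) BELOW the deviation point
a.e. — LOSES on at least `2^{n-1}/49` odd inputs.  The deviation point itself may JUMP within the pair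
`{k, k+1}` along flip orbits (the ±1 selector jitter: not frozen, so the degree-free law §3 is silent, and three
flips are useless, §4): this is the Smolensky + `10/16`-core content.  (`pointer_certificate_loss` with the selector
`f_k := devA P k`, plus the trace form.) -/
theorem anchoredDev_loss (c : ℕ) : ∃ n₀ : ℕ, ∀ n ≥ n₀, ∀ P A : Fin n → CubeFn (ZMod 3) n,
    (∀ i, P i ∈ lowDeg (ZMod 3) n ((Nat.log 2 n) ^ c)) → (∀ k, A k ∈ lowDeg (ZMod 3) n ((Nat.log 2 n) ^ c)) →
    4096 * (univ.filter fun x : Fin n → Bool =>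
        OddZeros x ∧ (univ.filter fun k : Fin n => A k x = 1).card ≠ 1).card ≤ 2 ^ (n - 1) →
    4096 * (∑ a ∈ range n, (univ.filter fun x : Fin n → Bool =>
        OddZeros x ∧ ∃ k : Fin n, ¬ ((A k (flip2 a (a + 1) x) = 1) ↔ (A k x = 1))).card) ≤ n * 2 ^ (n - 1) →
    4096 * (univ.filter fun x : Fin n → Bool => OddZeros x ∧ (dev P x).card ≠ 1).card ≤ 2 ^ (n - 1) →
    4096 * (univ.filter fun x : Fin n → Bool => OddZeros x ∧
        ¬ ∃ k : Fin n, A k x = 1 ∧ ∀ i ∈ dev P x, i.val = k.val ∨ i.val = (k.val + 1) % n).card ≤ 2 ^ (n - 1) →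
      2 ^ (n - 1) ≤ 49 * (univ.filter fun x : Fin n → Bool =>
        OddZeros x ∧ ¬ Rel x (fun i => decide (P i x = 1))).card := by
  obtain ⟨n₀, hn₀⟩ := pointer_certificate_loss (c + 1)
  refine ⟨max n₀ 64, fun n hn P A hP hA hU hS hD hN => ?_⟩
  have hn64 : 64 ≤ n := le_trans (le_max_right _ _) hn
  have hbump := deg_bump4 n c hn64
  have hA' : ∀ k, A k ∈ lowDeg (ZMod 3) n ((Nat.log 2 n) ^ (c + 1)) := fun k =>
    lowDeg_mono (by omega) (hA k)
  have hf' : ∀ k, devA P k ∈ lowDeg (ZMod 3) n ((Nat.log 2 n) ^ (c + 1)) := fun k =>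
    lowDeg_mono (by omega) (devA_mem hP k)
  have key := hn₀ n (le_trans (le_max_left _ _) hn) A (devA P) hA' hf' hU hS
  set SU := univ.filter fun x : Fin n → Bool =>
    OddZeros x ∧ (univ.filter fun k : Fin n => A k x = 1).card ≠ 1 with hSU
  set SD := univ.filter fun x : Fin n → Bool => OddZeros x ∧ (dev P x).card ≠ 1 with hSD
  set SN := univ.filter fun x : Fin n → Bool => OddZeros x ∧
    ¬ ∃ k : Fin n, A k x = 1 ∧ ∀ i ∈ dev P x, i.val = k.val ∨ i.val = (k.val + 1) % n with hSN
  set SL := univ.filter fun x : Fin n → Bool => OddZeros x ∧ ¬ Rel x (fun i => decide (P i x = 1)) with hSL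
  have hsub : (univ.filter fun x : Fin n → Bool => OddZeros x ∧
      ¬ ∃ k : Fin n, (univ.filter fun k' : Fin n => A k' x = 1) = {k} ∧
        gCond x ((k.val + (if devA P k x = 1 then 0 else 1)) % n)) ⊆ ((SU ∪ SD) ∪ SN) ∪ SL := by
    intro x hx
    rw [mem_filter] at hx
    obtain ⟨-, hodd, hno⟩ := hx
    by_cases h1 : (univ.filter fun k : Fin n => A k x = 1).card = 1
    swap
    · exact mem_union_left _ (mem_union_left _ (mem_union_left _ (mem_filter.2 ⟨mem_univ _, hodd, h1⟩)))
    by_cases h2 : (dev P x).card = 1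
    swap
    · exact mem_union_left _ (mem_union_left _ (mem_union_right _ (mem_filter.2 ⟨mem_univ _, hodd, h2⟩)))
    by_cases h3 : ∃ k : Fin n, A k x = 1 ∧ ∀ i ∈ dev P x, i.val = k.val ∨ i.val = (k.val + 1) % n
    swap
    · exact mem_union_left _ (mem_union_right _ (mem_filter.2 ⟨mem_univ _, hodd, h3⟩))
    refine mem_union_right _ (mem_filter.2 ⟨mem_univ _, hodd, fun hrel => hno ?_⟩)
    obtain ⟨k₀, hk₀⟩ := card_eq_one.1 h1
    obtain ⟨p, hp⟩ := card_eq_one.1 h2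
    obtain ⟨k, hkA, hnear⟩ := h3
    have hkk : k = k₀ := by
      have hmem : k ∈ (univ.filter fun k : Fin n => A k x = 1) := mem_filter.2 ⟨mem_univ _, hkA⟩
      rw [hk₀, mem_singleton] at hmem
      exact hmem
    subst hkk
    have hg : gCond x p.val := by
      have hw := (win_iff (by omega) P x hodd).1 hrel
      rw [hp, filter_singleton] at hw
      by_contra hg
      rw [if_neg hg, card_empty] at hw
      exact absurd hw (by norm_num)
    have hpk := hnear p (by rw [hp]; exact mem_singleton_self _)
    refine ⟨k, hk₀, ?_⟩
    rcases hpk with hpk | hpk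
    · have hpeq : p = k := Fin.ext hpk
      have h1' : devA P k x = 1 := by
        rw [devA_apply_eq_one, hp, hpeq]; exact mem_singleton_self _
      rw [if_pos h1', add_zero, Nat.mod_eq_of_lt k.isLt, ← hpk]
      exact hg
    · have hne : devA P k x ≠ 1 := by
        rw [Ne, devA_apply_eq_one, hp, mem_singleton]
        intro hkp
        rw [hkp] at hpk
        have hplt := p.isLt
        by_cases hlt : p.val + 1 < n
        · rw [Nat.mod_eq_of_lt hlt] at hpk; omega
        · have heq : p.val + 1 = n := by omega
          rw [heq, Nat.mod_self] at hpk; omega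
      rw [if_neg hne, ← hpk]
      exact hg
  have hcard := card_le_card hsub
  have hu1 := card_union_le ((SU ∪ SD) ∪ SN) SL
  have hu2 := card_union_le (SU ∪ SD) SN
  have hu3 := card_union_le SU SD
  omega

/-- ANCHORABLE (at degree budget `(log₂ N)^c`): the strategy admits a coarse anchor family as in `anchoredDev_loss`
— uni-deviation a.e., and SOME degree-`(log₂ N)^c` family of anchor indicators that is a.e. unique, flip-stable,
and at or one step below the deviation point a.e. -/
def Anchorable (c : ℕ) (P : Fin N → CubeFn (ZMod 3) N) : Prop :=
  ∃ A : Fin N → CubeFn (ZMod 3) N, (∀ k, A k ∈ lowDeg (ZMod 3) N ((Nat.log 2 N) ^ c)) ∧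
    4096 * (univ.filter fun x : Fin N → Bool =>
        OddZeros x ∧ (univ.filter fun k : Fin N => A k x = 1).card ≠ 1).card ≤ 2 ^ (N - 1) ∧
    4096 * (∑ a ∈ range N, (univ.filter fun x : Fin N → Bool =>
        OddZeros x ∧ ∃ k : Fin N, ¬ ((A k (flip2 a (a + 1) x) = 1) ↔ (A k x = 1))).card) ≤ N * 2 ^ (N - 1) ∧
    4096 * (univ.filter fun x : Fin N → Bool => OddZeros x ∧ (dev P x).card ≠ 1).card ≤ 2 ^ (N - 1) ∧
    4096 * (univ.filter fun x : Fin N → Bool => OddZeros x ∧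
        ¬ ∃ k : Fin N, A k x = 1 ∧ ∀ i ∈ dev P x, i.val = k.val ∨ i.val = (k.val + 1) % N).card ≤ 2 ^ (N - 1)

/-- **PIECE (typed residual, rev 7) `NoAnchorLoss3` — `T` RESTRICTED TO UN-ANCHORABLE STRATEGIES**: multi-point
deviation sets on `≥ 2^{-12}` of the odd class, or a deviation point under which NO polylog-degree coarse anchor is
simultaneously unique, flip-stable and within one step.  `T ⟺ NoAnchorLoss3` (`polyLossOddU3_iff_noAnchorLoss3`); the
excluded (anchorable) class is settled by `anchoredDev_loss` and is STRICTLY BEYOND LEVEL 0 (it contains every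
«deviate at `k(x)` or `k(x)+1` by a polylog selector» strategy with `k` stable — not frozen).  `≡ T`; IDEA-NEEDED;
BARRIER-ADJACENT (small-set Smolensky). -/
def NoAnchorLoss3 : Prop :=
  ∃ C : ℕ, ∀ c : ℕ, ∃ n₀ : ℕ, ∀ n ≥ n₀, ∀ P : Fin n → CubeFn (ZMod 3) n,
    (∀ i, P i ∈ lowDeg (ZMod 3) n ((Nat.log 2 n) ^ c)) → ¬ Anchorable c P →
      ((univ.filter fun x : Fin n → Bool => OddZeros x ∧ Rel x (fun i => decide (P i x = 1))).card : ℝ) ≤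
        (1 - 1 / (n : ℝ) ^ C) * (2 : ℝ) ^ (n - 1)

/-- restriction: `T → NoAnchorLoss3`. -/
theorem noAnchorLoss3_of_polyLossOddU3 (h : ExactnessDial.PolyLossOddU3) : NoAnchorLoss3 := by
  obtain ⟨C, hC⟩ := h
  refine ⟨C, fun c => ?_⟩
  obtain ⟨n₀, hn₀⟩ := hC c
  exact ⟨n₀, fun n hn P hP _ => hn₀ n hn P hP⟩

/-- **dichotomy: `NoAnchorLoss3 → T`** — anchorable strategies by the law `anchoredDev_loss` (constant loss
`1/49 ≥ 1/n`), the rest by the residual. -/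
theorem polyLossOddU3_of_noAnchorLoss3 (h : NoAnchorLoss3) : ExactnessDial.PolyLossOddU3 := by
  obtain ⟨C, hR⟩ := h
  refine ⟨max C 1, fun c => ?_⟩
  obtain ⟨n₁, hn₁⟩ := hR c
  obtain ⟨n₂, hn₂⟩ := anchoredDev_loss c
  refine ⟨max (max n₁ n₂) 49, fun n hn P hP => ?_⟩
  have hn1 : n₁ ≤ n := le_trans (le_trans (le_max_left _ _) (le_max_left _ _)) hn
  have hn2 : n₂ ≤ n := le_trans (le_trans (le_max_right _ _) (le_max_left _ _)) hn
  have hn49 : 49 ≤ n := le_trans (le_max_right _ _) hn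
  have hP0 : (0 : ℝ) ≤ (2 : ℝ) ^ (n - 1) := by positivity
  by_cases hc : Anchorable c P
  · obtain ⟨A, hA, hU, hS, hD, hN⟩ := hc
    have hL := hn₂ n hn2 P A hP hA hU hS hD hN
    have hWL := Finset.card_filter_add_card_filter_not
      (s := (univ : Finset (Fin n → Bool)).filter fun x => OddZeros x)
      (fun x => Rel x (fun i => decide (P i x = 1)))
    rw [filter_filter, filter_filter] at hWL
    have hO' := HolonomyDial.card_odd_le (n := n) (by omega)
    have h48 : 49 * (univ.filter fun x : Fin n → Bool =>
        OddZeros x ∧ Rel x (fun i => decide (P i x = 1))).card ≤ 48 * 2 ^ (n - 1) := by omega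
    have hfin : n * (univ.filter fun x : Fin n → Bool =>
        OddZeros x ∧ Rel x (fun i => decide (P i x = 1))).card + 2 ^ (n - 1) ≤ n * 2 ^ (n - 1) := by
      have h1 := Nat.mul_le_mul_left n h48
      rw [Nat.mul_left_comm n 49, Nat.mul_left_comm n 48] at h1
      have h2 := Nat.mul_le_mul_right (2 ^ (n - 1)) hn49
      omega
    have hreal := real_tail n _ (2 ^ (n - 1)) (by omega) hfin
    push_cast at hreal
    exact loss_shape_mono (by omega) (le_max_right C 1) _ _ hP0 hreal
  · exact loss_shape_mono (by omega) (le_max_left C 1) _ _ hP0 (hn₁ n hn1 P hP hc)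

/-- **NODE EQUATION, rev 7**: `T ⟺ NoAnchorLoss3`. -/
theorem polyLossOddU3_iff_noAnchorLoss3 : ExactnessDial.PolyLossOddU3 ↔ NoAnchorLoss3 :=
  ⟨noAnchorLoss3_of_polyLossOddU3, polyLossOddU3_of_noAnchorLoss3⟩

/-- all residual typings agree: `NoAnchorLoss3 ⟺ MultiDevLoss3 ⟺ PtrLocLift3 ⟺ T`. -/
theorem noAnchorLoss3_iff_multiDevLoss3 : NoAnchorLoss3 ↔ MultiDevLoss3 :=
  polyLossOddU3_iff_noAnchorLoss3.symm.trans polyLossOddU3_iff_multiDevLoss3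

/-- **closes, rev-7 form**. -/
theorem closes_noAnchor (hR : NoAnchorLoss3) (hD : ExactnessDial.DPLift3) : AdviceFreeQNC0Three :=
  closes_T (polyLossOddU3_of_noAnchorLoss3 hR) hD

/-- the un-anchorable class is non-empty (the canonical guess is not uni-deviation). -/
theorem not_anchorable_canonical (hN : 1 ≤ N) (c : ℕ) : ¬ Anchorable (N := N) c (fun i => tPoly i) := by
  rintro ⟨A, -, -, -, hD, -⟩
  exact not_uniDev_canonical hN hD

/-- the rev-7 special class CONTAINS the rev-6 one: a uni-deviation, flip-stable strategy is anchorable by its own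
deviation indicators (`A := devA P`), one degree step up. -/
theorem anchorable_of_uniDev_stabDev {c : ℕ} (hN : 64 ≤ N) {P : Fin N → CubeFn (ZMod 3) N}
    (hP : ∀ i, P i ∈ lowDeg (ZMod 3) N ((Nat.log 2 N) ^ c)) (hU : UniDev P) (hS : StabDev P) :
    Anchorable (c + 1) P := by
  have hbump := deg_bump4 N c hN
  refine ⟨devA P, fun k => lowDeg_mono (by omega) (devA_mem hP k), ?_, ?_, hU, ?_⟩
  · simp_rw [anc_devA]; exact hU
  · have e : ∀ a : ℕ, (univ.filter fun x : Fin N → Bool => OddZeros x ∧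
        ∃ k : Fin N, ¬ ((devA P k (flip2 a (a + 1) x) = 1) ↔ (devA P k x = 1))) =
        (univ.filter fun x : Fin N → Bool => OddZeros x ∧ dev P (flip2 a (a + 1) x) ≠ dev P x) := by
      intro a; ext x
      simp only [mem_filter, mem_univ, true_and, devA_apply_eq_one]
      rw [Ne, Finset.ext_iff, not_forall]
    simp_rw [e]; exact hS
  · refine le_trans (Nat.mul_le_mul_left 4096 (card_le_card fun x hx => ?_)) hU
    rw [mem_filter] at hx ⊢
    refine ⟨mem_univ _, hx.2.1, fun h1 => hx.2.2 ?_⟩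
    obtain ⟨p, hp⟩ := card_eq_one.1 h1
    refine ⟨p, ?_, fun i hi => Or.inl ?_⟩
    · rw [devA_apply_eq_one, hp]; exact mem_singleton_self _
    · rw [hp, mem_singleton] at hi; rw [hi]

end Anchored

section Tightness

/-- adjacent positions are never null: `c_{k+1} ∈ {c_k + 1, c_k + 2}`, so the walk condition cannot fail at two
consecutive positions. -/
theorem gCond_succ_of_not (x : Fin N → Bool) {k : ℕ} (hk : k < N) (h : ¬ gCond x k) : gCond x (k + 1) := by
  rw [gCond_iff_cN] at h ⊢
  rw [cN_succ x k hk]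
  rw [not_ne_iff] at h
  split_ifs <;> omega

/-- the omniscient jitter pointer: `0` if the walk condition holds at `0`, else `1` (reads the hidden trit). -/
def jitPtr (x : Fin N → Bool) : ℕ := if gCond x 0 then 0 else 1

/-- AnchorDialAnchored helper `jitPtr_le_one` (decomp-qadv land package; see the module docstring). -/
theorem jitPtr_le_one (x : Fin N → Bool) : jitPtr x ≤ 1 := by
  unfold jitPtr; split_ifs <;> omega

/-- the UNBOUNDED-degree jitter strategy: deviate from the canonical guess exactly at `jitPtr x`. -/
def jitStrat (i : Fin N) : CubeFn (ZMod 3) N := fun x =>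
  if (xor (tGuess x i) (decide (i.val = jitPtr x))) = true then 1 else 0

/-- the constant anchor family `A_k := [k = 0]` (degree `0`). -/
def zeroAnchor (k : Fin N) : CubeFn (ZMod 3) N := if k.val = 0 then 1 else 0

/-- AnchorDialAnchored helper `zeroAnchor_mem` (decomp-qadv land package; see the module docstring). -/
theorem zeroAnchor_mem (k : Fin N) : zeroAnchor k ∈ lowDeg (ZMod 3) N 0 := by
  unfold zeroAnchor
  split_ifs
  · exact one_mem_lowDeg 0
  · exact Submodule.zero_mem _

/-- AnchorDialAnchored helper `zeroAnchor_apply_eq_one` (decomp-qadv land package; see the module docstring). -/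
theorem zeroAnchor_apply_eq_one (k : Fin N) (x : Fin N → Bool) : zeroAnchor k x = 1 ↔ k.val = 0 := by
  unfold zeroAnchor
  split_ifs with h
  · simp [h]
  · simp [h]

/-- AnchorDialAnchored helper `jitStrat_apply_eq_one` (decomp-qadv land package; see the module docstring). -/
theorem jitStrat_apply_eq_one (i : Fin N) (x : Fin N → Bool) :
    jitStrat i x = 1 ↔ xor (tGuess x i) (decide (i.val = jitPtr x)) = true := by
  unfold jitStrat
  split_ifs with h
  · simp [h]
  · simp [h]

/-- AnchorDialAnchored helper `dev_jitStrat` (decomp-qadv land package; see the module docstring). -/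
theorem dev_jitStrat (hN : 2 ≤ N) (x : Fin N → Bool) :
    dev jitStrat x = {⟨jitPtr x, lt_of_le_of_lt (jitPtr_le_one x) (by omega)⟩} := by
  ext k
  rw [dev, mem_filter, mem_singleton, Fin.ext_iff]
  simp only [mem_univ, true_and]
  simp_rw [jitStrat_apply_eq_one]
  cases tGuess x k <;> simp

/-- **DEGREE IS NECESSARY IN `anchoredDev_loss` (tightness, rev 7).**  With the constant anchor family
`A_k := [k = 0]` (degree `0`; unique and flip-stable on EVERY input) the unbounded-degree jitter strategy «deviate
at `0` if the walk condition holds there, else at `1`» has a single deviation point within one step of the anchor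
on every input and WINS ON EVERY ODD INPUT (`gCond_succ_of_not`): all four exceptional sets of `anchoredDev_loss`
and the losing set are EMPTY.  So the anchored class admits no degree-free law (unlike the level-0 class,
`uniDev_loss_degfree`): the ±1 selector jitter is exactly where polylog degree / Smolensky enters. -/
theorem anchoredDev_loss_needs_degree (hN : 3 ≤ N) :
    ∃ P A : Fin N → CubeFn (ZMod 3) N,
      (∀ k, A k ∈ lowDeg (ZMod 3) N 0) ∧
      (univ.filter fun x : Fin N → Bool =>
          OddZeros x ∧ (univ.filter fun k : Fin N => A k x = 1).card ≠ 1) = ∅ ∧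
      (∀ a : ℕ, (univ.filter fun x : Fin N → Bool =>
          OddZeros x ∧ ∃ k : Fin N, ¬ ((A k (flip2 a (a + 1) x) = 1) ↔ (A k x = 1))) = ∅) ∧
      (univ.filter fun x : Fin N → Bool => OddZeros x ∧ (dev P x).card ≠ 1) = ∅ ∧
      (univ.filter fun x : Fin N → Bool => OddZeros x ∧
          ¬ ∃ k : Fin N, A k x = 1 ∧ ∀ i ∈ dev P x, i.val = k.val ∨ i.val = (k.val + 1) % N) = ∅ ∧
      (univ.filter fun x : Fin N → Bool => OddZeros x ∧ ¬ Rel x (fun i => decide (P i x = 1))) = ∅ := by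
  have hN0 : 0 < N := by omega
  have hanc : ∀ x : Fin N → Bool, (univ.filter fun k : Fin N => zeroAnchor k x = 1) = {⟨0, hN0⟩} := by
    intro x; ext k
    rw [mem_filter, mem_singleton, zeroAnchor_apply_eq_one, Fin.ext_iff]
    simp
  refine ⟨jitStrat, zeroAnchor, zeroAnchor_mem, ?_, ?_, ?_, ?_, ?_⟩
  · refine filter_eq_empty_iff.2 fun x _ h => h.2 ?_
    rw [hanc x, card_singleton]
  · intro a
    refine filter_eq_empty_iff.2 fun x _ h => ?_
    obtain ⟨k, hk⟩ := h.2
    exact hk (by rw [zeroAnchor_apply_eq_one, zeroAnchor_apply_eq_one])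
  · refine filter_eq_empty_iff.2 fun x _ h => h.2 ?_
    rw [dev_jitStrat (by omega) x, card_singleton]
  · refine filter_eq_empty_iff.2 fun x _ h =>
      h.2 ⟨⟨0, hN0⟩, (zeroAnchor_apply_eq_one _ _).2 rfl, fun i hi => ?_⟩
    rw [dev_jitStrat (by omega) x, mem_singleton] at hi
    rw [hi]
    show jitPtr x = 0 ∨ jitPtr x = (0 + 1) % N
    unfold jitPtr
    split_ifs
    · exact Or.inl rfl
    · right; rw [Nat.mod_eq_of_lt (by omega)]
  · refine filter_eq_empty_iff.2 fun x _ h => h.2 ?_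
    have hodd := h.1
    change Rel x (outB jitStrat x)
    rw [win_iff hN jitStrat x hodd, dev_jitStrat (by omega) x, filter_singleton]
    have hg : gCond x (jitPtr x) := by
      unfold jitPtr
      split_ifs with h0
      · exact h0
      · exact gCond_succ_of_not x hN0 h0
    rw [if_pos hg, card_singleton]

end Tightness

end Summit.QuantumAdvantage.QuantumAdvantage.Theorems.AnchorDial

end
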